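import Summits.ValiantsHypothesis.ValiantsHypothesis.Theorems.BarrierLeverAnchoredDoorHitsLowerPairsStarPivot

/-!
# Route BarrierLever — support item `AnchoredDoorHitsLowerPairs` (stmt-ValiantsHypothesis-22510), line `anchored_peeling`:
# THE SMALL COLUMNS OF THE STAR-FOREST MATRIX and the KERNEL VECTOR behind the refutation of STAR-LOWER (val-np-p1 g36)

Helper file (`--supports stmt-ValiantsHypothesis-22510`). Closes NO item; nothing here bears on crux 14610 or on `VP ≠ VNP`, which is NOT proved.
Used by …StarLowerRefutation (`not_conjStarLower`).

CONTENTS. (1) Closed forms of the columns of size ≤ 2 for EVERY row `A` (`starEntry_col_empty/_singleton/_pair`):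
`M[A,∅] = 1`, `M[A,{e}] = ∏_{b∈A}(1+g_{be}) + Σ_{b∈A} d_{be}`,
`M[A,{e,e'}] = ∏_{b∈A}(1+g_{be}+g_{be'}) + Σ_{b∈A} d_{be'}∏_{c∈A∖b}(1+g_{ce}) + Σ_{b∈A} d_{be}∏_{c∈A∖b}(1+g_{ce'}) + (Σ_b d_{be})(Σ_b d_{be'})`.
(2) THE Δ-FORMULA on rows of size ≤ 3 (`starDelta_eq_deltaRHS`): with `h = g + d` and `e ≠ e'`,
`M[A,{e,e'}] − M[A,{e}] − M[A,{e'}] + M[A,∅] = Σ_{b∈A} d_{be}d_{be'} + Σ_{b≠b'∈A} h_{be}h_{b'e'} + [|A|=3]·Σ_{c∈A}(h_{ce'}∏_{b∈A∖c}g_{be} + h_{ce}∏_{b∈A∖c}g_{be'})`.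
(3) THE KERNEL VECTOR (`kerVec`, `sum_starEntry_mul_kerVec`, `sum_starDelta_eq_zero`): for vectors `U`, `V` on the column vertices with disjoint
supports (`U_e V_e = 0`) and `U ⊥ h_c`, `U ⊥ d_c`, `V ⊥ h_c` for the vertices `c` of a row `A` of size ≤ 3, the column vector
`y_S = Σ_{e,e'} U_e V_{e'}([S=∅] − [S={e}] − [S={e'}] + [S={e,e'}])` pairs to zero with the row `A` over any column family containing `∅`, all
singletons and all pairs.
-/

set_option linter.dupNamespace false

namespace Summit.ValiantsHypothesis.ValiantsHypothesis.Theorems.BarrierLever.AnchoredPeeling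

open Finset

noncomputable section

namespace StarDoor

variable {K : Type*} [CommRing K] {h : ℕ}

/-! ## 1. Closed forms of the columns of size ≤ 2 (every row `A`) -/

/-- `Σ_{A' ⊆ A} (∏_{b ∈ A ∖ A'} 0) · F A' = F A`: only `A' = A` survives. -/
theorem sum_powerset_prod_zero_mul (A : Finset (Fin h)) (F : Finset (Fin h) → K) :
    ∑ A' ∈ A.powerset, (∏ _b ∈ A \ A', (0 : K)) * F A' = F A := by
  classical
  rw [Finset.sum_eq_single A]
  · rw [Finset.sdiff_self, Finset.prod_empty, one_mul]
  · intro A' hA' hne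
    have hsub : A' ⊆ A := Finset.mem_powerset.mp hA'
    obtain ⟨b, hb⟩ : (A \ A').Nonempty := by
      rw [Finset.sdiff_nonempty]; exact fun hAA' => hne (Finset.Subset.antisymm hsub hAA')
    rw [Finset.prod_eq_zero hb rfl, zero_mul]
  · intro hA; exact absurd (Finset.mem_powerset.mpr (Finset.Subset.refl A)) hA

/-- `Σ_{A' ⊆ A} ∏_{b ∈ A ∖ A'} c b = ∏_{b ∈ A} (1 + c b)`. -/
theorem sum_powerset_prod_sdiff (A : Finset (Fin h)) (c : Fin h → K) :
    ∑ A' ∈ A.powerset, ∏ b ∈ A \ A', c b = ∏ b ∈ A, (1 + c b) := by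
  classical
  rw [Finset.prod_add]
  refine Finset.sum_congr rfl fun A' _ => ?_
  rw [Finset.prod_const_one, one_mul]

/-- The one-leaf-column sum: `Σ_{A' ⊆ A} (∏_{b ∈ A ∖ A'} c b) · Σ_{b ∈ A'} v b = Σ_{b ∈ A} v b · ∏_{x ∈ A ∖ {b}} (1 + c x)`. -/
theorem sum_powerset_prod_sdiff_mul_sum (A : Finset (Fin h)) (c v : Fin h → K) :
    ∑ A' ∈ A.powerset, (∏ b ∈ A \ A', c b) * ∑ b ∈ A', v b = ∑ b ∈ A, v b * ∏ x ∈ A.erase b, (1 + c x) := by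
  classical
  -- write the inner sum over `b ∈ A` with an indicator and exchange
  have h1 : ∀ A' ∈ A.powerset, (∏ b ∈ A \ A', c b) * ∑ b ∈ A', v b
      = ∑ b ∈ A, if b ∈ A' then v b * ∏ x ∈ A \ A', c x else 0 := by
    intro A' hA'
    have hsub : A' ⊆ A := Finset.mem_powerset.mp hA'
    rw [Finset.mul_sum, ← Finset.sum_filter]
    have hfil : A.filter (fun b => b ∈ A') = A' := by
      ext b; rw [Finset.mem_filter]; exact ⟨fun hb => hb.2, fun hb => ⟨hsub hb, hb⟩⟩
    rw [hfil]
    exact Finset.sum_congr rfl fun b _ => by ring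
  rw [Finset.sum_congr rfl h1, Finset.sum_comm]
  refine Finset.sum_congr rfl fun b hb => ?_
  -- Σ_{A' ⊆ A, b ∈ A'} ∏_{A ∖ A'} c = ∏_{x ∈ A.erase b} (1 + c x)
  rw [← Finset.sum_filter]
  have hbij : ∑ A' ∈ A.powerset.filter (fun A' => b ∈ A'), v b * ∏ x ∈ A \ A', c x
      = ∑ A'' ∈ (A.erase b).powerset, v b * ∏ x ∈ (A.erase b) \ A'', c x := by
    refine Finset.sum_bij' (fun A' _ => A'.erase b) (fun A'' _ => insert b A'') ?_ ?_ ?_ ?_ ?_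
    · intro A' hA'
      rw [Finset.mem_filter, Finset.mem_powerset] at hA'
      exact Finset.mem_powerset.mpr (Finset.erase_subset_erase b hA'.1)
    · intro A'' hA''
      have hsub : A'' ⊆ A.erase b := Finset.mem_powerset.mp hA''
      rw [Finset.mem_filter, Finset.mem_powerset]
      exact ⟨Finset.insert_subset hb (hsub.trans (Finset.erase_subset b A)), Finset.mem_insert_self b A''⟩
    · intro A' hA'
      rw [Finset.mem_filter] at hA'
      exact Finset.insert_erase hA'.2
    · intro A'' hA''
      have hsub : A'' ⊆ A.erase b := Finset.mem_powerset.mp hA''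
      have hbA'' : b ∉ A'' := fun h' => Finset.notMem_erase b A (hsub h')
      exact Finset.erase_insert hbA''
    · intro A' hA'
      rw [Finset.mem_filter] at hA'
      congr 1
      apply Finset.prod_congr _ (fun _ _ => rfl)
      ext x
      simp only [Finset.mem_sdiff, Finset.mem_erase]
      constructor
      · rintro ⟨hxA, hxA'⟩
        have hxb : x ≠ b := fun hxb => hxA' (hxb ▸ hA'.2)
        exact ⟨⟨hxb, hxA⟩, fun h' => hxA' h'.2⟩
      · rintro ⟨⟨hxb, hxA⟩, hx⟩
        exact ⟨hxA, fun h' => hx ⟨hxb, h'⟩⟩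
  rw [hbij, ← Finset.mul_sum, sum_powerset_prod_sdiff]

/-- Sum over the power set of a singleton. -/
theorem sum_powerset_one {M : Type*} [AddCommMonoid M] (e : Fin h) (F : Finset (Fin h) → M) :
    ∑ S' ∈ ({e} : Finset (Fin h)).powerset, F S' = F ∅ + F {e} := by
  classical
  rw [← Finset.insert_empty, Finset.sum_powerset_insert (Finset.notMem_empty e), Finset.powerset_empty,
    Finset.sum_singleton, Finset.sum_singleton, Finset.insert_empty]

/-- **Column `∅`:** `starEntry g d A ∅ = 1` for every `A`. -/
theorem starEntry_col_empty (g d : Fin h → Fin h → K) (A : Finset (Fin h)) : starEntry g d A ∅ = 1 := by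
  classical
  unfold starEntry
  rw [Finset.powerset_empty]
  simp only [Finset.sum_singleton, Finset.sum_empty, Finset.sdiff_self, Finset.prod_empty]
  exact sum_powerset_prod_zero_mul A (fun _ => 1)

/-- **Column `{e}`:** `starEntry g d A {e} = ∏_{b ∈ A} (1 + g b e) + Σ_{b ∈ A} d b e`. -/
theorem starEntry_col_singleton (g d : Fin h → Fin h → K) (A : Finset (Fin h)) (e : Fin h) :
    starEntry g d A {e} = (∏ b ∈ A, (1 + g b e)) + ∑ b ∈ A, d b e := by
  classical
  unfold starEntry
  rw [Finset.sum_congr rfl fun A' _ => sum_powerset_one e _]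
  simp only [Finset.sum_empty, Finset.sdiff_empty, Finset.prod_singleton, Finset.sum_singleton, Finset.sdiff_self,
    Finset.prod_empty, mul_one, Finset.sum_add_distrib]
  rw [sum_powerset_prod_zero_mul, sum_powerset_prod_sdiff, add_comm]

/-- **Column `{e, e'}`** (`e ≠ e'`): `starEntry g d A {e,e'} = ∏_{b∈A}(1 + g b e + g b e') + Σ_{b∈A} d b e' ∏_{c∈A∖b}(1 + g c e)
  + Σ_{b∈A} d b e ∏_{c∈A∖b}(1 + g c e') + (Σ_{b∈A} d b e)(Σ_{b∈A} d b e')`. -/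
theorem starEntry_col_pair (g d : Fin h → Fin h → K) (A : Finset (Fin h)) {e e' : Fin h} (hee : e ≠ e') :
    starEntry g d A {e, e'} = (∏ b ∈ A, (1 + g b e + g b e')) + (∑ b ∈ A, d b e' * ∏ c ∈ A.erase b, (1 + g c e))
      + (∑ b ∈ A, d b e * ∏ c ∈ A.erase b, (1 + g c e')) + (∑ b ∈ A, d b e) * (∑ b ∈ A, d b e') := by
  classical
  unfold starEntry
  have hnot : e ∉ ({e'} : Finset (Fin h)) := fun h' => hee (Finset.mem_singleton.mp h')
  rw [show ({e, e'} : Finset (Fin h)) = insert e {e'} from rfl]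
  rw [Finset.sum_congr rfl fun A' _ => Finset.sum_powerset_insert hnot _]
  rw [Finset.sum_congr rfl fun A' _ => by rw [sum_powerset_one e', sum_powerset_one e']]
  -- the four small set computations
  have h1 : insert e ({e'} : Finset (Fin h)) \ ∅ = {e, e'} := Finset.sdiff_empty
  have h2 : insert e ({e'} : Finset (Fin h)) \ {e'} = {e} := by
    rw [Finset.insert_sdiff_of_notMem _ hnot, Finset.sdiff_self, insert_empty_eq]
  have h3 : insert e ({e'} : Finset (Fin h)) \ {e} = {e'} := by
    rw [Finset.insert_sdiff_of_mem _ (Finset.mem_singleton_self e), Finset.sdiff_singleton_eq_erase,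
      Finset.erase_eq_of_notMem hnot]
  have h4 : insert e ({e'} : Finset (Fin h)) \ insert e {e'} = ∅ := Finset.sdiff_self _
  simp only [Finset.insert_empty, h1, h2, h3, h4, Finset.sum_empty, Finset.prod_empty, Finset.sum_singleton, Finset.prod_singleton,
    Finset.prod_pair hee, Finset.sum_pair hee, mul_one, Finset.sum_add_distrib]
  rw [sum_powerset_prod_zero_mul, sum_powerset_prod_sdiff_mul_sum, sum_powerset_prod_sdiff_mul_sum, sum_powerset_prod_sdiff]
  ring

/-! ## 2. The second difference of the columns on rows of size ≤ 3 -/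

/-- `Δ_{ee'}(A) := M[A,{e,e'}] − M[A,{e}] − M[A,{e'}] + M[A,∅]`. -/
def starDelta (g d : Fin h → Fin h → K) (A : Finset (Fin h)) (e e' : Fin h) : K :=
  starEntry g d A {e, e'} - starEntry g d A {e} - starEntry g d A {e'} + starEntry g d A ∅

/-- The right-hand side of the Δ-formula: with `h = g + d`,
`Σ_{b∈A} d_{be}d_{be'} + Σ_{b ≠ b' ∈ A} h_{be}h_{b'e'} + [|A| = 3]·Σ_{c∈A}(h_{ce'}∏_{b∈A∖c} g_{be} + h_{ce}∏_{b∈A∖c} g_{be'})`. -/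
def deltaRHS (g d : Fin h → Fin h → K) (A : Finset (Fin h)) (e e' : Fin h) : K :=
  (∑ b ∈ A, d b e * d b e') + (∑ b ∈ A, ∑ b' ∈ A.erase b, (g b e + d b e) * (g b' e' + d b' e'))
    + (if A.card = 3 then ∑ c ∈ A, ((g c e' + d c e') * ∏ b ∈ A.erase c, g b e + (g c e + d c e) * ∏ b ∈ A.erase c, g b e') else 0)

/-- **THE Δ-FORMULA on rows of size ≤ 3.** -/
theorem starDelta_eq_deltaRHS (g d : Fin h → Fin h → K) {A : Finset (Fin h)} (hA : A.card ≤ 3) {e e' : Fin h} (hee : e ≠ e') :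
    starDelta g d A e e' = deltaRHS g d A e e' := by
  classical
  unfold starDelta deltaRHS
  rw [starEntry_col_pair g d A hee, starEntry_col_singleton, starEntry_col_singleton, starEntry_col_empty]
  have hcases : A.card = 0 ∨ A.card = 1 ∨ A.card = 2 ∨ A.card = 3 := by omega
  rcases hcases with h0 | h1 | h2 | h3
  · rw [Finset.card_eq_zero] at h0
    subst h0
    simp
  · obtain ⟨x, rfl⟩ := Finset.card_eq_one.mp h1
    simp [Finset.sum_singleton, Finset.prod_singleton, Finset.erase_singleton]
    ring
  · obtain ⟨x, y, hxy, rfl⟩ := Finset.card_eq_two.mp h2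
    have hx : x ∉ ({y} : Finset (Fin h)) := fun h' => hxy (Finset.mem_singleton.mp h')
    simp [Finset.sum_insert hx, Finset.prod_insert hx, Finset.erase_insert hx, Finset.erase_insert_of_ne hxy,
      Finset.erase_singleton, Finset.card_insert_of_notMem hx]
    ring
  · obtain ⟨x, y, z, hxy, hxz, hyz, rfl⟩ := Finset.card_eq_three.mp h3
    have hx : x ∉ ({y, z} : Finset (Fin h)) := by
      simp only [Finset.mem_insert, Finset.mem_singleton, not_or]; exact ⟨hxy, hxz⟩
    have hy : y ∉ ({z} : Finset (Fin h)) := fun h' => hyz (Finset.mem_singleton.mp h')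
    simp [Finset.sum_insert hx, Finset.prod_insert hx, Finset.sum_insert hy, Finset.prod_insert hy, Finset.erase_insert hx,
      Finset.erase_insert hy, Finset.erase_insert_of_ne hxy, Finset.erase_insert_of_ne hxz, Finset.erase_insert_of_ne hyz,
      Finset.erase_singleton, Finset.card_insert_of_notMem hx, Finset.card_insert_of_notMem hy, hxy, hxz]
    ring

/-! ## 3. The kernel vector -/

/-- The column coefficient `[S = ∅] − [S = {e}] − [S = {e'}] + [S = {e,e'}]`. -/
def pairCoef (S : Finset (Fin h)) (e e' : Fin h) : K :=
  (if S = ∅ then 1 else 0) - (if S = {e} then 1 else 0) - (if S = {e'} then 1 else 0) + (if S = {e, e'} then 1 else 0)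

/-- The kernel vector on the columns: `y_S = Σ_{e,e'} U_e V_{e'} · pairCoef S e e'`. -/
def kerVec (U V : Fin h → K) (S : Finset (Fin h)) : K := ∑ e, ∑ e', U e * V e' * pairCoef S e e'

/-- Bilinear factorisation used three times. -/
theorem sum_sum_mul_mul (U V X Y : Fin h → K) :
    ∑ e, ∑ e', U e * V e' * (X e * Y e') = (∑ e, U e * X e) * ∑ e', V e' * Y e' := by
  rw [Finset.sum_mul_sum]
  exact Finset.sum_congr rfl fun e _ => Finset.sum_congr rfl fun e' _ => by ring

/-- Pull a finite sum out of the double `U`-`V` sum. -/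
theorem sum_sum_mul_finsum {ι : Type*} (B : Finset ι) (U V : Fin h → K) (G : ι → Fin h → Fin h → K) :
    ∑ e, ∑ e', U e * V e' * ∑ b ∈ B, G b e e' = ∑ b ∈ B, ∑ e, ∑ e', U e * V e' * G b e e' := by
  have hmul : ∀ e e', U e * V e' * ∑ b ∈ B, G b e e' = ∑ b ∈ B, U e * V e' * G b e e' := fun e e' => Finset.mul_sum _ _ _
  simp_rw [hmul]
  calc ∑ e, ∑ e', ∑ b ∈ B, U e * V e' * G b e e' = ∑ e, ∑ b ∈ B, ∑ e', U e * V e' * G b e e' :=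
        Finset.sum_congr rfl fun e _ => Finset.sum_comm
    _ = ∑ b ∈ B, ∑ e, ∑ e', U e * V e' * G b e e' := Finset.sum_comm

/-- Additivity of the double `U`-`V` sum. -/
theorem sum_sum_mul_add (U V : Fin h → K) (P Q : Fin h → Fin h → K) :
    ∑ e, ∑ e', U e * V e' * (P e e' + Q e e') = (∑ e, ∑ e', U e * V e' * P e e') + ∑ e, ∑ e', U e * V e' * Q e e' := by
  rw [← Finset.sum_add_distrib]
  refine Finset.sum_congr rfl fun e _ => ?_
  rw [← Finset.sum_add_distrib]
  exact Finset.sum_congr rfl fun e' _ => by ring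

/-- `Σ_{e,e'} U_e V_{e'} · deltaRHS(A,e,e') = 0` when `U ⊥ h_c`, `U ⊥ d_c`, `V ⊥ h_c` for the vertices `c` of `A`. -/
theorem sum_deltaRHS_eq_zero (g d : Fin h → Fin h → K) (A : Finset (Fin h)) (U V : Fin h → K)
    (HU : ∀ c ∈ A, ∑ e, U e * (g c e + d c e) = 0) (DU : ∀ c ∈ A, ∑ e, U e * d c e = 0)
    (HV : ∀ c ∈ A, ∑ e, V e * (g c e + d c e) = 0) :
    ∑ e, ∑ e', U e * V e' * deltaRHS g d A e e' = 0 := by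
  classical
  have part1 : ∑ e, ∑ e', U e * V e' * (∑ b ∈ A, d b e * d b e') = 0 := by
    rw [sum_sum_mul_finsum A U V (fun b e e' => d b e * d b e')]
    refine Finset.sum_eq_zero fun b hb => ?_
    rw [sum_sum_mul_mul, DU b hb, zero_mul]
  have part2 : ∑ e, ∑ e', U e * V e' * (∑ b ∈ A, ∑ b' ∈ A.erase b, (g b e + d b e) * (g b' e' + d b' e')) = 0 := by
    rw [sum_sum_mul_finsum A U V (fun b e e' => ∑ b' ∈ A.erase b, (g b e + d b e) * (g b' e' + d b' e'))]
    refine Finset.sum_eq_zero fun b hb => ?_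
    rw [sum_sum_mul_finsum (A.erase b) U V (fun b' e e' => (g b e + d b e) * (g b' e' + d b' e'))]
    refine Finset.sum_eq_zero fun b' _ => ?_
    rw [sum_sum_mul_mul, HU b hb, zero_mul]
  have part3 : ∑ e, ∑ e', U e * V e' * (∑ c ∈ A, ((g c e' + d c e') * ∏ b ∈ A.erase c, g b e
      + (g c e + d c e) * ∏ b ∈ A.erase c, g b e')) = 0 := by
    rw [sum_sum_mul_finsum A U V (fun c e e' => (g c e' + d c e') * ∏ b ∈ A.erase c, g b e + (g c e + d c e) * ∏ b ∈ A.erase c, g b e')]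
    refine Finset.sum_eq_zero fun c hc => ?_
    have hre : ∀ e e', U e * V e' * ((g c e' + d c e') * ∏ b ∈ A.erase c, g b e + (g c e + d c e) * ∏ b ∈ A.erase c, g b e')
        = U e * V e' * (((∏ b ∈ A.erase c, g b e) * (g c e' + d c e')) + ((g c e + d c e) * ∏ b ∈ A.erase c, g b e')) :=
      fun e e' => by ring
    simp_rw [hre]
    rw [sum_sum_mul_add, sum_sum_mul_mul, sum_sum_mul_mul, HV c hc, HU c hc, mul_zero, zero_mul, add_zero]
  unfold deltaRHS
  by_cases h3 : A.card = 3
  · simp only [h3, if_true]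
    rw [sum_sum_mul_add, sum_sum_mul_add, part1, part2, part3, add_zero, add_zero]
  · simp only [h3, if_false, add_zero]
    rw [sum_sum_mul_add, part1, part2, add_zero]

/-- The kernel identity on a row of size ≤ 3: `Σ_{e,e'} U_e V_{e'} Δ_{ee'}(A) = 0`
(disjoint supports `U_e V_e = 0` take care of the diagonal). -/
theorem sum_starDelta_eq_zero (g d : Fin h → Fin h → K) {A : Finset (Fin h)} (hA : A.card ≤ 3) (U V : Fin h → K)
    (UV : ∀ e, U e * V e = 0)
    (HU : ∀ c ∈ A, ∑ e, U e * (g c e + d c e) = 0) (DU : ∀ c ∈ A, ∑ e, U e * d c e = 0)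
    (HV : ∀ c ∈ A, ∑ e, V e * (g c e + d c e) = 0) :
    ∑ e, ∑ e', U e * V e' * starDelta g d A e e' = 0 := by
  have hterm : ∀ e e', U e * V e' * starDelta g d A e e' = U e * V e' * deltaRHS g d A e e' := by
    intro e e'
    by_cases hee : e = e'
    · subst hee; rw [UV e, zero_mul, zero_mul]
    · rw [starDelta_eq_deltaRHS g d hA hee]
  simp_rw [hterm]
  exact sum_deltaRHS_eq_zero g d A U V HU DU HV

/-- Pairing a row against the kernel vector over a column family containing `∅`, all singletons and all pairs:
`Σ_{S ∈ FJ} M[A,S] · y_S = Σ_{e,e'} U_e V_{e'} Δ_{ee'}(A)`. -/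
theorem sum_starEntry_mul_kerVec (g d : Fin h → Fin h → K) (A : Finset (Fin h)) (U V : Fin h → K)
    (FJ : Finset (Finset (Fin h))) (h0 : ∅ ∈ FJ) (h1 : ∀ e, ({e} : Finset (Fin h)) ∈ FJ) (h2 : ∀ e e', ({e, e'} : Finset (Fin h)) ∈ FJ) :
    ∑ S ∈ FJ, starEntry g d A S * kerVec U V S = ∑ e, ∑ e', U e * V e' * starDelta g d A e e' := by
  classical
  unfold kerVec
  have hswap : ∑ S ∈ FJ, starEntry g d A S * ∑ e, ∑ e', U e * V e' * pairCoef S e e'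
      = ∑ e, ∑ e', U e * V e' * ∑ S ∈ FJ, starEntry g d A S * pairCoef S e e' := by
    simp_rw [Finset.mul_sum]
    rw [Finset.sum_comm]
    refine Finset.sum_congr rfl fun e _ => ?_
    rw [Finset.sum_comm]
    refine Finset.sum_congr rfl fun e' _ => Finset.sum_congr rfl fun S _ => by ring
  rw [hswap]
  refine Finset.sum_congr rfl fun e _ => Finset.sum_congr rfl fun e' _ => ?_
  congr 1
  unfold pairCoef starDelta
  simp only [mul_add, mul_sub, Finset.sum_add_distrib, Finset.sum_sub_distrib, mul_ite, mul_one, mul_zero,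
    Finset.sum_ite_eq' FJ, h0, h1, h2, if_true]
  ring

end StarDoor

end

end Summit.ValiantsHypothesis.ValiantsHypothesis.Theorems.BarrierLever.AnchoredPeeling
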